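import Summits.ResolutionOfSingularities.ResolutionOfSingularities.Theorems.FrobeniusClosingPatchingRelPerfectMonomialRouteKWin
import Summits.ResolutionOfSingularities.ResolutionOfSingularities.Theorems.FrobeniusClosingPatchingRelPerfectMonomialPolyhedraGameMarked
import HarnessLib

/-!
# Crux `PatchingRelPerfect` (stmt-ResolutionOfSingularities-16161), chain W5.2 — F7(β) (β-AX) X3 C-II: the MULTI-HOST TAIL THEOREM
# `MultiHostTailTerminates` (idea-1 Sketch v13 §3) DERIVED from the tree's polyhedra game (Route K, marking 1)

[OURS · L1 W5.2 · F7(β) (β-AX) X3 `PhaseCTermination₂` C-II · STATEMENTS (§1) = res-L1-w52-idea-1 g12 `Sketch-L1-idea-1-v13.lean` §3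
VERBATIM, credited (`Table`, `Table.IsVacated/StripLegal/strip/LineLegal/lineChart/drop/PointLegal/pointChart`, `Terminates`,
`MultiHostTailTerminates`); res-L1-w52-plan-1 NAMING G11-32 / RULING G11-30 (C-II = Bierstone–Milman arXiv:math/0411340 Thm 8.5, `e = 1`);
PROOF (§2–§3) = res-L1-w52-stub-1 g5].  Replaces the role of NO printed item; NOT a statement of the manuscript under review (AI-written,
weaker than expert review).

THE POINT: Bierstone–Milman 8.5 with marking `1` is ALREADY a tree theorem in chart-free global form — `PolyhedraGame.routeKTarget :
1 ≤ m → RouteKTarget m`, `RouteKTarget 1 = ∀ s, s.WF → WinnableAll 1 s` (Hironaka's polyhedra game with marking `1`: centres = non-empty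
strata inside the cosupport, controlled transform `c = 1`, win = «at every stratum some generator has weight `0`», all fresh names).  §2
SIMULATES idea-1's pointwise table game inside it: a point over the origin is an injective labelling `lab : Fin 3 → B` of the slots, the set
`P` of slots whose letters pass (`P.image lab` a stratum) and the local table `L` = the global exponents read on the present slots (`localRow`);
a global permissible move either misses the point (`simulate` recurses on the same local data) or is `lab '' I`, `I ⊆ P`, and then the
`strip` / `line` / `point` constructors are fed with the children read at the strata `insert e (…)` of `moveStrata` (`child`, one lemma for
every chart `c ∈ I` and dropped set `D ⊆ I ∖ {c}`; `moveExp J e 1` IS the «sum over the centre's slots minus one» law of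
`…DepthPhaseCMonomialTailLaws`).  §3: **`multiHostTailTerminates`** = `routeKTarget le_rfl` on `⟨{0,1,2}, 𝒫{0,1,2}, rows⟩` + `simulate`.
Fact-free; zero new mathematics (dictionary = tri-2 v11.9 AC5, G11-29 (5)).  STATUS (RULING G11-36): DEFERRED/BANKED — the C-II ∃-level closer
is T4 on the residual; this file is the certified GERM-LEVEL engine, kept off the critical path.

## References
* E. Bierstone, P. Milman, *Desingularization of toric and binomial varieties*, J. Alg. Geom. 15 (2006), Thm 8.5, Rem 8.6. [BierstoneMilman2006]
* J. Kollár, *Lectures on Resolution of Singularities* (2007), (3.111) Step 3. [Kollar2007]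
-/

-- `Summit.<Summit>.<Sub>.Theorems` with `Sub = Summit` (single-conjunct summit, D-0017)
set_option linter.dupNamespace false

namespace Summit.ResolutionOfSingularities.ResolutionOfSingularities.Theorems.X3Tail

open Finset PolyhedraGame

/-! ## §1 The multi-host tail as an ∃-form exponent-table theorem (idea-1 Sketch v13 §3, verbatim) -/

/-- [OURS · idea-1 Sketch v13] Exponent table of the residual on the carrier: one row per monomial generator, three letters. -/
abbrev Table : Type := List (Fin 3 → ℕ)

namespace Table
/-- [OURS · idea-1 Sketch v13] The residual is a unit: some generator has become `1`. -/
def IsVacated (T : Table) : Prop := ∃ α ∈ T, α = 0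
/-- [OURS · idea-1 Sketch v13] STRIP along the member trace `V(q_ℓ)`: legal iff every generator involves `ℓ`. -/
def StripLegal (T : Table) (ℓ : Fin 3) : Prop := ∀ α ∈ T, 1 ≤ α ℓ
/-- [OURS · idea-1 Sketch v13] Effect of the strip (weight one): every generator loses one `q_ℓ`. -/
def strip (T : Table) (ℓ : Fin 3) : Table := T.map fun α => Function.update α ℓ (α ℓ - 1)
/-- [OURS · idea-1 Sketch v13] LINE `V(q_c, q_d)`: legal iff every generator involves `c` or `d`. -/
def LineLegal (T : Table) (c d : Fin 3) : Prop := c ≠ d ∧ ∀ α ∈ T, 1 ≤ α c + α d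
/-- [OURS · idea-1 Sketch v13] Chart of letter `c` of the line blow-up (exceptional letter in slot `c`, weight-one division). -/
def lineChart (T : Table) (c d : Fin 3) : Table := T.map fun α => Function.update α c (α c + α d - 1)
/-- [OURS · idea-1 Sketch v13] A strict-transform letter that no longer passes through the point becomes a unit. -/
def drop (T : Table) (ℓ : Fin 3) : Table := T.map fun α => Function.update α ℓ 0
/-- [OURS · idea-1 Sketch v13] POINT blow-up: legal iff the point lies in the cosupport (no generator is a unit). -/
def PointLegal (T : Table) : Prop := ∀ α ∈ T, 1 ≤ α 0 + α 1 + α 2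
/-- [OURS · idea-1 Sketch v13] Chart of letter `c` of the point blow-up. -/
def pointChart (T : Table) (c : Fin 3) : Table := T.map fun α => Function.update α c (α 0 + α 1 + α 2 - 1)

end Table

/-- [OURS · idea-1 Sketch v13 / memo §14.11] Finite legal move trees ending in VACATED tables at every point over the point. -/
inductive Terminates : Table → Prop
  | vac {T : Table} : T.IsVacated → Terminates T
  | strip {T : Table} (ℓ : Fin 3) : T.StripLegal ℓ → Terminates (T.strip ℓ) → Terminates T
  | line {T : Table} (c d : Fin 3) : T.LineLegal c d →
      Terminates (T.lineChart c d) → Terminates (T.lineChart d c) →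
      Terminates ((T.lineChart c d).drop d) → Terminates ((T.lineChart d c).drop c) → Terminates T
  | point {T : Table} : T.PointLegal →
      (∀ c, Terminates (T.pointChart c)) → (∀ c ℓ, ℓ ≠ c → Terminates ((T.pointChart c).drop ℓ)) →
      (∀ c, Terminates (((T.pointChart c).drop (c + 1)).drop (c + 2))) → Terminates T

/-- [OURS · idea-1 Sketch v13 / memo §14.11 · RULING G11-29 (5) P3b] **MULTI-HOST TAIL THEOREM (statement, ∃-form).**  Every non-empty
exponent table admits a finite legal move tree vacating the residual at every point over the point.  (= Bierstone–Milman arXiv:math/0411340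
Thm 8.5 for `P = N`, `e = 1`.) -/
def MultiHostTailTerminates : Prop := ∀ T : Table, T ≠ [] → Terminates T


/-! ## §2 Simulation inside the global polyhedra game with marking `1` -/

section Simulation

/-- [OURS] The local row of a global exponent vector at the point `(lab, P)`: the exponents of the letters through the point, `0` on the
slots whose letter does not pass. -/
def localRow (lab : Fin 3 → ℕ) (P : Finset (Fin 3)) (a : ℕ →₀ ℕ) : Fin 3 → ℕ :=
  fun i => if i ∈ P then a (lab i) else 0

/-- [OURS] The local row after a move with centre slots `I`, read in the chart of slot `c ∈ I` at the point where the strict transforms of the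
slots in `D ⊆ I ∖ {c}` are dropped: slot `c` carries `Σ_{i ∈ I} αᵢ − 1`, the slots in `D` carry `0`, the rest is kept. -/
def newRow (I : Finset (Fin 3)) (c : Fin 3) (D : Finset (Fin 3)) (α : Fin 3 → ℕ) : Fin 3 → ℕ :=
  fun i => if i ∈ D then 0 else if i = c then (∑ j ∈ I, α j) - 1 else α i

variable {s : State}

/-- The weight of a vector on the image stratum is the sum of the local row over the slots. [folklore] -/
theorem weight_image_eq (lab : Fin 3 → ℕ) (hlab : Function.Injective lab) {P I : Finset (Fin 3)} (hI : I ⊆ P) (a : ℕ →₀ ℕ) :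
    weight (I.image lab) a = ∑ i ∈ I, localRow lab P a i := by
  rw [weight, Finset.sum_image fun x _ y _ h => hlab h]
  exact Finset.sum_congr rfl fun i hi => by rw [localRow, if_pos (hI hi)]

/-- A won state vacates the local table. [folklore] -/
theorem isVacated_of_wonM (hwon : WonM 1 s) {lab : Fin 3 → ℕ} {P : Finset (Fin 3)} {L : Table} (hstr : P.image lab ∈ s.Str)
    (hrows : ∀ a ∈ s.A, localRow lab P a ∈ L) : L.IsVacated := by
  obtain ⟨a, ha, h0⟩ := (wonM_one_iff s).mp hwon _ hstr
  refine ⟨localRow lab P a, hrows a ha, funext fun i => ?_⟩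
  unfold localRow
  split_ifs with hi
  exacts [h0 _ (Finset.mem_image_of_mem lab hi), rfl]

/-- Off the centre nothing changes locally. [folklore] -/
theorem localRow_moveExp_of_not_mem {lab : Fin 3 → ℕ} {P : Finset (Fin 3)} (hmem : ∀ i, lab i ∈ s.B) {e : ℕ} (he : e ∉ s.B)
    (J : Finset ℕ) (a : ℕ →₀ ℕ) : localRow lab P (moveExp J e 1 a) = localRow lab P a := by
  funext i
  unfold localRow
  split_ifs
  exacts [moveExp_apply_of_ne a fun h => he (h ▸ hmem i), rfl]

/-- **The child law**: at the point of the chart `c ∈ I` where the slots `D ⊆ I ∖ {c}` are dropped, the local row of the moved vector is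
`newRow I c D` of the old local row — the «sum over the centre's slots minus one» law of `…DepthPhaseCMonomialTailLaws`. [folklore] -/
theorem localRow_moveExp (hs : s.WF) {lab : Fin 3 → ℕ} (hlab : Function.Injective lab) (hmem : ∀ i, lab i ∈ s.B) {P I D : Finset (Fin 3)}
    (hI : I ⊆ P) {c : Fin 3} (hc : c ∈ I) (hcD : c ∉ D) {e : ℕ} (he : e ∉ s.B) {a : ℕ →₀ ℕ} (ha : a ∈ s.A) :
    localRow (Function.update lab c e) (P \ D) (moveExp (I.image lab) e 1 a) = newRow I c D (localRow lab P a) := by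
  have hea : e ∉ a.support := fun h => he (hs.support_subset a ha h)
  funext i
  unfold newRow
  by_cases hiD : i ∈ D
  · rw [if_pos hiD, localRow, if_neg (fun h => (Finset.mem_sdiff.mp h).2 hiD)]
  rw [if_neg hiD]
  by_cases hic : i = c
  · subst hic
    rw [if_pos rfl, localRow, if_pos (Finset.mem_sdiff.mpr ⟨hI hc, hcD⟩), Function.update_self, moveExp_apply_self a hea,
      weight_image_eq lab hlab hI]
  · rw [if_neg hic, localRow, localRow, Function.update_of_ne hic]
    by_cases hiP : i ∈ P
    · rw [if_pos (Finset.mem_sdiff.mpr ⟨hiP, hiD⟩), if_pos hiP]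
      exact moveExp_apply_of_ne a fun h => he (h ▸ hmem i)
    · rw [if_neg (fun h => hiP (Finset.mem_sdiff.mp h).1), if_neg hiP]

/-- The image stratum of the child point: `(P ∖ D).image (update lab c e) = insert e (((P ∖ D).erase c).image lab)`. [folklore] -/
theorem image_update_eq {lab : Fin 3 → ℕ} {P D : Finset (Fin 3)} {c : Fin 3} (hc : c ∈ P \ D) (e : ℕ) :
    (P \ D).image (Function.update lab c e) = insert e (((P \ D).erase c).image lab) := by
  ext x
  simp only [Finset.mem_image, Finset.mem_insert, Finset.mem_erase]
  refine ⟨?_, ?_⟩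
  · rintro ⟨i, hi, rfl⟩
    by_cases hic : i = c
    · exact Or.inl (by rw [hic, Function.update_self])
    · exact Or.inr ⟨i, ⟨hic, hi⟩, by rw [Function.update_of_ne hic]⟩
  · rintro (rfl | ⟨i, ⟨hic, hi⟩, rfl⟩)
    · exact ⟨c, hc, by rw [Function.update_self]⟩
    · exact ⟨i, hi, by rw [Function.update_of_ne hic]⟩

/-- **The child point lies in the new stratum complex.** [folklore] -/
theorem image_update_mem_moveStrata (hs : s.WF) {lab : Fin 3 → ℕ} (hlab : Function.Injective lab) {P I D : Finset (Fin 3)}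
    (hstr : P.image lab ∈ s.Str) (hI : I ⊆ P) {c : Fin 3} (hc : c ∈ I) (hcD : c ∉ D) (e : ℕ) :
    (P \ D).image (Function.update lab c e) ∈ moveStrata s.Str (I.image lab) e := by
  rw [image_update_eq (Finset.mem_sdiff.mpr ⟨hI hc, hcD⟩)]
  refine mem_moveStrata_iff.mpr (Or.inr ⟨((P \ D).erase c).image lab, ?_, ?_, ?_, rfl⟩)
  · exact hs.str_down _ hstr _ (Finset.image_subset_image ((Finset.erase_subset _ _).trans Finset.sdiff_subset))
  · intro h
    have : lab c ∈ ((P \ D).erase c).image lab := h (Finset.mem_image_of_mem lab hc)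
    obtain ⟨i, hi, hli⟩ := Finset.mem_image.mp this
    exact (Finset.mem_erase.mp hi).1 (hlab hli)
  · refine hs.str_down _ hstr _ (Finset.union_subset ?_ (Finset.image_subset_image hI))
    exact Finset.image_subset_image ((Finset.erase_subset _ _).trans Finset.sdiff_subset)

/-- The updated labelling is injective and lands in the new index set. [folklore] -/
theorem update_injective {lab : Fin 3 → ℕ} (hlab : Function.Injective lab) (hmem : ∀ i, lab i ∈ s.B) (c : Fin 3) {e : ℕ}
    (he : e ∉ s.B) : Function.Injective (Function.update lab c e) := by
  intro i j hij
  by_cases hi : i = c <;> by_cases hj : j = c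
  · rw [hi, hj]
  · rw [hi, Function.update_self, Function.update_of_ne hj] at hij; exact absurd (hij ▸ hmem j) he
  · rw [hj, Function.update_self, Function.update_of_ne hi] at hij; exact absurd (hij.symm ▸ hmem i) he
  · rw [Function.update_of_ne hi, Function.update_of_ne hj] at hij; exact hlab hij

/-- **One child of a move**: the local data at the point of chart `c ∈ I`, dropped slots `D ⊆ I ∖ {c}`, of the moved state. [folklore] -/
theorem child (hs : s.WF) {lab : Fin 3 → ℕ} (hlab : Function.Injective lab) (hmem : ∀ i, lab i ∈ s.B) {P : Finset (Fin 3)} {L : Table}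
    (hstr : P.image lab ∈ s.Str) (hrows₁ : ∀ a ∈ s.A, localRow lab P a ∈ L) (hrows₂ : ∀ α ∈ L, ∃ a ∈ s.A, localRow lab P a = α)
    {I D : Finset (Fin 3)} (hI : I ⊆ P) {c : Fin 3} (hc : c ∈ I) (hcD : c ∉ D) {e : ℕ} (he : e ∉ s.B) :
    let s' := move s (I.image lab) e 1
    let lab' := Function.update lab c e
    (∀ i, lab' i ∈ s'.B) ∧ (P \ D).image lab' ∈ s'.Str ∧
      (∀ a ∈ s'.A, localRow lab' (P \ D) a ∈ L.map (newRow I c D)) ∧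
      (∀ α ∈ L.map (newRow I c D), ∃ a ∈ s'.A, localRow lab' (P \ D) a = α) := by
  refine ⟨fun i => ?_, image_update_mem_moveStrata hs hlab hstr hI hc hcD e, fun a' ha' => ?_, fun α hα => ?_⟩
  · show Function.update lab c e i ∈ insert e s.B
    by_cases hi : i = c
    exacts [by rw [hi, Function.update_self]; exact Finset.mem_insert_self _ _,
      by rw [Function.update_of_ne hi]; exact Finset.mem_insert_of_mem (hmem i)]
  · obtain ⟨a, ha, rfl⟩ := Finset.mem_image.mp ha'
    rw [localRow_moveExp hs hlab hmem hI hc hcD he ha]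
    exact List.mem_map.mpr ⟨_, hrows₁ a ha, rfl⟩
  · obtain ⟨β, hβ, rfl⟩ := List.mem_map.mp hα
    obtain ⟨a, ha, rfl⟩ := hrows₂ β hβ
    exact ⟨moveExp (I.image lab) e 1 a, Finset.mem_image_of_mem _ ha, localRow_moveExp hs hlab hmem hI hc hcD he ha⟩

/-! ### The local tables of the constructors as `newRow` maps -/

/-- `strip ℓ = map (newRow {ℓ} ℓ ∅)`. [folklore] -/
theorem strip_eq (L : Table) (ℓ : Fin 3) : L.strip ℓ = L.map (newRow {ℓ} ℓ ∅) := by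
  refine List.map_congr_left fun α _ => funext fun i => ?_
  simp only [newRow, Finset.notMem_empty, if_false, Finset.sum_singleton, Function.update_apply]

/-- `lineChart c d = map (newRow {c, d} c ∅)` (`c ≠ d`). [folklore] -/
theorem lineChart_eq (L : Table) {c d : Fin 3} (hcd : c ≠ d) : L.lineChart c d = L.map (newRow {c, d} c ∅) := by
  refine List.map_congr_left fun α _ => funext fun i => ?_
  simp only [newRow, Finset.notMem_empty, if_false, Finset.sum_pair hcd, Function.update_apply]

/-- `(lineChart c d).drop d = map (newRow {c, d} c {d})` (`c ≠ d`). [folklore] -/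
theorem lineChart_drop_eq (L : Table) {c d : Fin 3} (hcd : c ≠ d) : (L.lineChart c d).drop d = L.map (newRow {c, d} c {d}) := by
  rw [Table.drop, lineChart_eq L hcd, List.map_map]
  refine List.map_congr_left fun α _ => funext fun i => ?_
  simp only [Function.comp_apply, newRow, Finset.notMem_empty, if_false, Finset.mem_singleton, Function.update_apply]

/-- `pointChart c = map (newRow univ c ∅)`. [folklore] -/
theorem pointChart_eq (L : Table) (c : Fin 3) : L.pointChart c = L.map (newRow Finset.univ c ∅) := by
  refine List.map_congr_left fun α _ => funext fun i => ?_
  simp only [newRow, Finset.notMem_empty, if_false, Fin.sum_univ_three, Function.update_apply]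

/-- `(pointChart c).drop ℓ = map (newRow univ c {ℓ})` (`ℓ ≠ c`). [folklore] -/
theorem pointChart_drop_eq (L : Table) {c ℓ : Fin 3} (_hℓ : ℓ ≠ c) : (L.pointChart c).drop ℓ = L.map (newRow Finset.univ c {ℓ}) := by
  rw [Table.drop, pointChart_eq, List.map_map]
  refine List.map_congr_left fun α _ => funext fun i => ?_
  simp only [Function.comp_apply, newRow, Finset.notMem_empty, if_false, Finset.mem_singleton, Function.update_apply]

/-- `((pointChart c).drop (c+1)).drop (c+2) = map (newRow univ c {c+1, c+2})`. [folklore] -/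
theorem pointChart_drop_drop_eq (L : Table) (c : Fin 3) :
    ((L.pointChart c).drop (c + 1)).drop (c + 2) = L.map (newRow Finset.univ c {c + 1, c + 2}) := by
  rw [Table.drop, pointChart_drop_eq L (show c + 1 ≠ c by fin_cases c <;> decide), List.map_map]
  refine List.map_congr_left fun α _ => funext fun i => ?_
  simp only [Function.comp_apply, newRow, Finset.mem_singleton, Finset.mem_insert, Function.update_apply]
  by_cases hi2 : i = c + 2
  · rw [if_pos hi2, if_pos (Or.inr hi2)]
  · rw [if_neg hi2]
    by_cases hi1 : i = c + 1
    · rw [if_pos hi1, if_pos (Or.inl hi1)]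
    · rw [if_neg hi1, if_neg (not_or.mpr ⟨hi1, hi2⟩)]

/-! ### The simulation -/

/-- [OURS · X3 C-II] **SIMULATION.**  From a state won in the marking-`1` polyhedra game (all fresh names), every point over the origin —
given by an injective slot labelling `lab`, the present slots `P` (their letters form a stratum) and the local table `L` read off the global
exponents — admits a terminating legal move tree in idea-1's sense. [cite: BierstoneMilman2006, Thm 8.5] -/
theorem simulate {s : State} (hw : WinnableAll 1 s) :
    s.WF → ∀ (lab : Fin 3 → ℕ) (P : Finset (Fin 3)) (L : Table), Function.Injective lab → (∀ i, lab i ∈ s.B) →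
      P.image lab ∈ s.Str → (∀ a ∈ s.A, localRow lab P a ∈ L) → (∀ α ∈ L, ∃ a ∈ s.A, localRow lab P a = α) → Terminates L := by
  induction hw with
  | done hwon =>
    intro _ lab P L _ _ hstr hrows₁ _
    exact Terminates.vac (isVacated_of_wonM hwon hstr hrows₁)
  | @step s J hJ hall ih =>
    intro hs lab P L hlab hmem hstr hrows₁ hrows₂
    -- a fresh name and the moved state
    have he : s.B.sup id + 1 ∉ s.B := sup_succ_notMem s
    set e := s.B.sup id + 1 with he_def
    have hs' : (move s J e 1).WF := WF.move hs J e 1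
    obtain ⟨hJstr, hJne, hJw⟩ := hJ
    by_cases hJP : J ⊆ P.image lab
    · -- the centre passes through the point: `J = I.image lab`
      set I : Finset (Fin 3) := P.filter fun i => lab i ∈ J with hI_def
      have hIP : I ⊆ P := Finset.filter_subset _ _
      have hJI : J = I.image lab := by
        refine Finset.ext fun x => ⟨fun hx => ?_, fun hx => ?_⟩
        · obtain ⟨i, hi, rfl⟩ := Finset.mem_image.mp (hJP hx)
          exact Finset.mem_image_of_mem lab (Finset.mem_filter.mpr ⟨hi, hx⟩)
        · obtain ⟨i, hi, rfl⟩ := Finset.mem_image.mp hx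
          exact (Finset.mem_filter.mp hi).2
      -- legality read locally
      have hleg : ∀ α ∈ L, 1 ≤ ∑ i ∈ I, α i := by
        intro α hα
        obtain ⟨a, ha, rfl⟩ := hrows₂ α hα
        rw [← weight_image_eq lab hlab hIP a, ← hJI]
        exact hJw a ha
      -- the generic child, as a `Terminates` of the mapped table
      have hchild : ∀ (c : Fin 3), c ∈ I → ∀ (D : Finset (Fin 3)), c ∉ D → Terminates (L.map (newRow I c D)) := by
        intro c hc D hcD
        obtain ⟨hmem', hstr', hrows₁', hrows₂'⟩ := child hs hlab hmem hstr hrows₁ hrows₂ hIP hc hcD he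
        rw [← hJI] at hstr' hrows₁' hrows₂'
        exact ih e he hs' _ _ _ (update_injective hlab hmem c he) hmem' hstr' hrows₁' hrows₂'
      -- the three move shapes, generically
      have hpoint : I = Finset.univ → Terminates L := by
        intro hIu
        refine Terminates.point (fun α hα => ?_) (fun c => ?_) (fun c ℓ hℓ => ?_) (fun c => ?_)
        · have := hleg α hα; rwa [hIu, Fin.sum_univ_three] at this
        · rw [pointChart_eq, ← hIu]; exact hchild c (hIu ▸ Finset.mem_univ c) ∅ (Finset.notMem_empty c)
        · rw [pointChart_drop_eq L hℓ, ← hIu]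
          exact hchild c (hIu ▸ Finset.mem_univ c) {ℓ} (by rw [Finset.mem_singleton]; exact hℓ.symm)
        · rw [pointChart_drop_drop_eq, ← hIu]
          refine hchild c (hIu ▸ Finset.mem_univ c) {c + 1, c + 2} ?_
          rw [Finset.mem_insert, Finset.mem_singleton, not_or]
          constructor <;> fin_cases c <;> decide
      have hline : ∀ c d : Fin 3, c ≠ d → I = {c, d} → Terminates L := by
        intro c d hcd hIe
        have hc : c ∈ I := hIe ▸ Finset.mem_insert_self c {d}
        have hd : d ∈ I := hIe ▸ Finset.mem_insert_of_mem (Finset.mem_singleton_self d)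
        have hIe' : I = {d, c} := hIe.trans (Finset.pair_comm c d)
        refine Terminates.line c d ⟨hcd, fun α hα => ?_⟩ ?_ ?_ ?_ ?_
        · have := hleg α hα; rwa [hIe, Finset.sum_pair hcd] at this
        · rw [lineChart_eq L hcd, ← hIe]; exact hchild c hc ∅ (Finset.notMem_empty c)
        · rw [lineChart_eq L hcd.symm, ← hIe']; exact hchild d hd ∅ (Finset.notMem_empty d)
        · rw [lineChart_drop_eq L hcd, ← hIe]
          exact hchild c hc {d} (by rw [Finset.mem_singleton]; exact hcd)
        · rw [lineChart_drop_eq L hcd.symm, ← hIe']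
          exact hchild d hd {c} (by rw [Finset.mem_singleton]; exact hcd.symm)
      have hstrip : ∀ ℓ : Fin 3, I = {ℓ} → Terminates L := by
        intro ℓ hIe
        have hℓ : ℓ ∈ I := hIe ▸ Finset.mem_singleton_self ℓ
        refine Terminates.strip ℓ (fun α hα => ?_) ?_
        · have := hleg α hα; rwa [hIe, Finset.sum_singleton] at this
        · rw [strip_eq, ← hIe]; exact hchild ℓ hℓ ∅ (Finset.notMem_empty ℓ)
      have hIne : I.Nonempty := by
        obtain ⟨x, hx⟩ := hJne
        obtain ⟨i, hi, -⟩ := Finset.mem_image.mp (hJI ▸ hx)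
        exact ⟨i, hi⟩
      -- decide the shape of `I ⊆ Fin 3`
      by_cases h0 : (0 : Fin 3) ∈ I <;> by_cases h1 : (1 : Fin 3) ∈ I <;> by_cases h2 : (2 : Fin 3) ∈ I
      · exact hpoint (Finset.eq_univ_of_forall fun i => by fin_cases i <;> assumption)
      · exact hline 0 1 (by decide) (Finset.ext fun i => by fin_cases i <;> simp [h0, h1, h2])
      · exact hline 0 2 (by decide) (Finset.ext fun i => by fin_cases i <;> simp [h0, h1, h2])
      · exact hstrip 0 (Finset.ext fun i => by fin_cases i <;> simp [h0, h1, h2])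
      · exact hline 1 2 (by decide) (Finset.ext fun i => by fin_cases i <;> simp [h0, h1, h2])
      · exact hstrip 1 (Finset.ext fun i => by fin_cases i <;> simp [h0, h1, h2])
      · exact hstrip 2 (Finset.ext fun i => by fin_cases i <;> simp [h0, h1, h2])
      · obtain ⟨i, hi⟩ := hIne
        exact absurd hi (by fin_cases i <;> assumption)
    · -- the centre misses the point: nothing changes locally
      have hstr' : P.image lab ∈ (move s J e 1).Str := mem_moveStrata_iff.mpr (Or.inl ⟨hstr, hJP⟩)
      refine ih e he hs' lab P L hlab (fun i => Finset.mem_insert_of_mem (hmem i)) hstr' ?_ ?_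
      · intro a' ha'
        obtain ⟨a, ha, rfl⟩ := Finset.mem_image.mp ha'
        rw [localRow_moveExp_of_not_mem hmem he]
        exact hrows₁ a ha
      · intro α hα
        obtain ⟨a, ha, rfl⟩ := hrows₂ α hα
        exact ⟨moveExp J e 1 a, Finset.mem_image_of_mem _ ha, localRow_moveExp_of_not_mem hmem he J a⟩

end Simulation

/-! ## §3 The theorem -/

section Theorem

/-- [OURS] The global exponent vector of a local row: `Σᵢ αᵢ · e_{i}` on the indices `0, 1, 2`. -/
noncomputable def toExp (α : Fin 3 → ℕ) : ℕ →₀ ℕ := ∑ i : Fin 3, Finsupp.single (i : ℕ) (α i)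

/-- Reading the global vector back on the slots. [folklore] -/
theorem toExp_apply_val (α : Fin 3 → ℕ) (i : Fin 3) : toExp α (i : ℕ) = α i := by
  rw [toExp, Finsupp.finsetSum_apply]
  simp_rw [Finsupp.single_apply, Fin.val_inj]
  rw [Finset.sum_ite_eq' Finset.univ i (fun j => α j), if_pos (Finset.mem_univ i)]

/-- The global vector is supported on `{0, 1, 2}`. [folklore] -/
theorem support_toExp_subset (α : Fin 3 → ℕ) : (toExp α).support ⊆ Finset.univ.image (fun i : Fin 3 => (i : ℕ)) := by
  intro n hn
  rw [toExp, Finsupp.mem_support_iff, Finsupp.finsetSum_apply] at hn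
  obtain ⟨i, -, hi⟩ := Finset.exists_ne_zero_of_sum_ne_zero hn
  rw [Finsupp.single_apply] at hi
  split_ifs at hi with h
  · exact Finset.mem_image.mpr ⟨i, Finset.mem_univ i, h⟩
  · exact absurd rfl hi

/-- The local row of `toExp α` at the origin (all three slots present) is `α` itself. [folklore] -/
theorem localRow_toExp (α : Fin 3 → ℕ) : localRow (fun i : Fin 3 => (i : ℕ)) Finset.univ (toExp α) = α := by
  funext i
  rw [localRow, if_pos (Finset.mem_univ i), toExp_apply_val]

/-- [OURS · X3 C-II · RULING G11-30 / NAMING G11-32] **THE MULTI-HOST TAIL THEOREM**: every non-empty exponent table admits a finite legal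
move tree vacating the residual at every point over the point — Bierstone–Milman Thm 8.5 (`e = 1`), here DERIVED from the tree's Route-K win
of Hironaka's polyhedra game with marking `1` (`PolyhedraGame.routeKTarget`) by the simulation `simulate`. [cite: BierstoneMilman2006, Thm 8.5] -/
theorem multiHostTailTerminates : MultiHostTailTerminates := by
  intro T hT
  classical
  -- the initial global state: three boundary indices, every stratum non-empty, the rows as exponent vectors
  let lab : Fin 3 → ℕ := fun i => (i : ℕ)
  let B₀ : Finset ℕ := Finset.univ.image lab
  let s₀ : State := ⟨B₀, B₀.powerset, (T.map toExp).toFinset⟩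
  have hlab : Function.Injective lab := Fin.val_injective
  have hWF : s₀.WF := by
    refine ⟨fun S hS => Finset.mem_powerset.mp hS, fun S hS S' hS' => ?_, fun a ha => ?_, ?_⟩
    · exact Finset.mem_powerset.mpr (hS'.trans (Finset.mem_powerset.mp hS))
    · obtain ⟨α, -, rfl⟩ := List.mem_map.mp (List.mem_toFinset.mp ha)
      exact support_toExp_subset α
    · obtain ⟨α, hα⟩ := List.exists_mem_of_ne_nil T hT
      exact ⟨toExp α, List.mem_toFinset.mpr (List.mem_map.mpr ⟨α, hα, rfl⟩)⟩
  have hw : WinnableAll 1 s₀ := routeKTarget le_rfl s₀ hWF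
  refine simulate hw hWF lab Finset.univ T hlab (fun i => Finset.mem_image_of_mem lab (Finset.mem_univ i))
    (Finset.mem_powerset.mpr subset_rfl) (fun a ha => ?_) (fun α hα => ?_)
  · obtain ⟨α, hα, rfl⟩ := List.mem_map.mp (List.mem_toFinset.mp ha)
    rw [localRow_toExp]
    exact hα
  · exact ⟨toExp α, List.mem_toFinset.mpr (List.mem_map.mpr ⟨α, hα, rfl⟩), localRow_toExp α⟩

end Theorem

end Summit.ResolutionOfSingularities.ResolutionOfSingularities.Theorems.X3Tail
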